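import Summits.AtomisticToContinuum.FouriersLaw.Theorems.BondHeatUncertaintyBoundedResponseBathHeatCumulantC
import HarnessLib

/-!
# Bounded response, bath heat: WickDefect / CumulantChannels (lens-1 NODE 108) — part 4 of 5 (sequel of `…BondHeatUncertaintyBoundedResponseBathHeatCumulantC`)

Split for the 400-line cap by the landing lane (hand-2 g39); the module docstring of part 1 (`…BondHeatUncertaintyBoundedResponseBathHeatCumulantA`) describes the whole node.  Same namespace; all FQNs unchanged.
0 sorry; standard axioms.
-/

noncomputable section
open MeasureTheory ProbabilityTheory Filter Topology Set Function
open scoped NNReal ENNReal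
open Literature.MathematicalPhysics.KineticTheory.HeatConduction
open Literature.MathematicalPhysics.KineticTheory OscillatorChain
open Literature.Probability.Process
open Summit.AtomisticToContinuum.FouriersLaw.Theorems.SubdiffusiveBondHeat
open Summit.AtomisticToContinuum.FouriersLaw.Theorems.SubdiffusiveBondHeat.EscapeGrading
open Summit.AtomisticToContinuum.FouriersLaw.Theorems.IncoherentChannel.Negative.KernelMoments
  (integrable_sq_momentum_transitionKernel harmonic_kernel_momentum harmonic_kernel_momentum_sq)
open Summit.AtomisticToContinuum.FouriersLaw.Theorems.IncoherentChannel.Negative.HarmonicFlow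
  (harmonic_chainFlow_zero_noise_linear integral_gibbsMeasure_eq_zero_of_odd)
open Summit.AtomisticToContinuum.FouriersLaw.Theorems.IncoherentChannel.Negative.GibbsStein
  (integrable_gibbsMeasure_of_growth pow_le_one_add_sq_sq gibbs_sq_momentum gibbs_momentum_mul_clm gibbs_sq_momentum_mul_clm_sq)
open Summit.AtomisticToContinuum.FouriersLaw.Cruxes.SuperadditiveResistance.FloatingProbeBypassLaplacian
  (integral_flip_gibbsMeasure integrable_flip_gibbsMeasure)

namespace Summit.AtomisticToContinuum.FouriersLaw.Theorems.BoundedResponse.HeatSpreading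

open Summit.AtomisticToContinuum.FouriersLaw.Theses.BondHeatUncertainty (BoundedResponse SubdiffusiveBondHeat)
open Summit.AtomisticToContinuum.FouriersLaw.Theorems.BoundedResponse.TransientBand
  (escapeKernel escapeTransient warburgDip TransientFloor WarburgDipFloor transientFloor_one_of_warburgDipFloor)

/-! ## §9 Concordance with GEN 92T (`TransientBand`): the bath tail floor IS the transient floor; the kernel floor gives the Warburg dip floor -/

/-- The two kernels of the lineage are one: `TransientBand.escapeKernel = bathKinCorr` (both VERBATIM the `dite` kernel of `escapeDeficit`). [formal bookkeeping] -/
theorem escapeKernel_eq_bathKinCorr (ω₂ lam β γ T : ℝ) (N : ℕ) (u : ℝ) :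
    escapeKernel ω₂ lam β γ T N u = bathKinCorr ω₂ lam β γ T N u := rfl

/-- `B_N(t) = γT²·Ov_N(t)` (`T ≠ 0`): NODE 107's bath tail functional is node B's escape transient up to the factor `γT²`. [formal bookkeeping] -/
theorem bathTail_eq_mul_escapeTransient {T : ℝ} (hT : T ≠ 0) (ω₂ lam β γ : ℝ) (N : ℕ) (t : ℝ) :
    bathTail ω₂ lam β γ T N t = γ * T ^ 2 * escapeTransient ω₂ lam β γ T N t := by
  unfold bathTail escapeTransient
  simp only [escapeKernel_eq_bathKinCorr]
  field_simp

/-- ★ **(BTᶠ_g) ⟺ (F_g)**: `BathTailFloor g ↔ TransientBand.TransientFloor g` at every grade (rescaling the constant by `γT²`). [this cell] -/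
theorem bathTailFloor_iff_transientFloor (g : ℝ) : BathTailFloor g ↔ TransientFloor g := by
  constructor
  · intro h ω₂ lam β γ hω hl hβ hγ T hT c hc
    obtain ⟨C, N₀, hC⟩ := h ω₂ lam β γ hω hl hβ hγ T hT c hc
    refine ⟨C / (γ * T ^ 2), N₀, fun N hN => ?_⟩
    have h1 := hC N hN
    rw [bathTail_eq_mul_escapeTransient hT.ne' ω₂ lam β γ N] at h1
    have hγT : 0 < γ * T ^ 2 := by positivity
    have h2 : -(C * (N : ℝ) ^ g) / (γ * T ^ 2) ≤ escapeTransient ω₂ lam β γ T N (c * (N : ℝ) ^ 2) := by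
      rw [div_le_iff₀ hγT]; linarith
    calc -(C / (γ * T ^ 2) * (N : ℝ) ^ g) = -(C * (N : ℝ) ^ g) / (γ * T ^ 2) := by ring
      _ ≤ _ := h2
  · intro h ω₂ lam β γ hω hl hβ hγ T hT c hc
    obtain ⟨C, N₀, hC⟩ := h ω₂ lam β γ hω hl hβ hγ T hT c hc
    refine ⟨γ * T ^ 2 * C, N₀, fun N hN => ?_⟩
    have h1 := hC N hN
    rw [bathTail_eq_mul_escapeTransient hT.ne' ω₂ lam β γ N]
    have hγT : 0 < γ * T ^ 2 := by positivity
    nlinarith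

/-- (CFᶠ_{0,3/2}) ⟹ (F₁) of node B (through (BTᶠ_1)). [formal bookkeeping] -/
theorem transientFloor_one_of_bathCumulantFloor (hC : BathCumulantFloor 0 (3 / 2)) : TransientFloor 1 :=
  (bathTailFloor_iff_transientFloor 1).1 (bathTailFloor_one_of_bathCumulantFloor hC)

section Warburg

variable {ω₂ lam β γ : ℝ} (hω : 0 < ω₂) (hl : 0 < lam) (hβ : 0 < β) (hγ : 0 < γ) {T : ℝ} (hT : 0 < T)
include hω hl hβ hγ hT

/-- **Kernel floor ⟹ dip floor at fixed `N`**: if `K_N(u) ≥ −A₊·u^{−3/2}` for `u ≥ r₀ > 0` (`A₊ ≥ 0`, `N ≥ 1`), then for `0 < ω ≤ 1`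
`∫_{(0,∞)} (1 − cos ωu) K_N(u) du ≥ −(A₊·c₂ + T²r₀³)·√ω` (`c₂ = ∫(1−cos v)/(v√v)`; on `(0,r₀]` use `1 − cos ωu ≤ ω²u²/2 ≤ √ω·r₀²/2` and `|K_N| ≤ 2T²`).
[folklore] -/
theorem integral_one_sub_cos_mul_bathKinCorr_ge {N : ℕ} (hN : 0 < N) {A r₀ : ℝ} (hA : 0 ≤ A) (hr₀ : 0 < r₀)
    (hK : ∀ u : ℝ, r₀ ≤ u → -(A * u ^ (-(3 / 2 : ℝ))) ≤ bathKinCorr ω₂ lam β γ T N u) {ω : ℝ} (hω0 : 0 < ω) (hω1 : ω ≤ 1) :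
    -((A * (∫ v in Ioi (0 : ℝ), (1 - Real.cos v) / (v * Real.sqrt v)) + T ^ 2 * r₀ ^ 3) * Real.sqrt ω) ≤
      ∫ u in Ioi (0 : ℝ), (1 - Real.cos (ω * u)) * bathKinCorr ω₂ lam β γ T N u := by
  obtain ⟨hKc, hKb, hKi⟩ := bathKinCorr_basics hω hl hβ hγ hT hN
  set c₂ : ℝ := ∫ v in Ioi (0 : ℝ), (1 - Real.cos v) / (v * Real.sqrt v) with hc₂
  -- the two dominating functions
  set L₁ : ℝ → ℝ := fun u => A * ((1 - Real.cos (u * ω)) / (u * Real.sqrt u)) with hL₁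
  set L₂ : ℝ → ℝ := fun u => Set.indicator (Set.Ioc 0 r₀) (fun _ => T ^ 2 * r₀ ^ 2 * Real.sqrt ω) u with hL₂
  have hL₁i : IntegrableOn L₁ (Ioi 0) := (integrableOn_one_sub_cos_mul_div_mul_sqrt hω0).const_mul A
  have hL₁v : ∫ u in Ioi (0 : ℝ), L₁ u = A * (Real.sqrt ω * c₂) := by
    rw [hL₁, integral_const_mul, integral_one_sub_cos_mul_div_mul_sqrt hω0]
  have hL₂i' : Integrable L₂ := by
    rw [hL₂, integrable_indicator_iff measurableSet_Ioc]
    exact integrableOn_const (C := T ^ 2 * r₀ ^ 2 * Real.sqrt ω) (by simp)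
  have hL₂i : IntegrableOn L₂ (Ioi 0) := hL₂i'.integrableOn
  have hL₂v : ∫ u in Ioi (0 : ℝ), L₂ u = T ^ 2 * r₀ ^ 2 * Real.sqrt ω * r₀ := by
    rw [hL₂, integral_indicator measurableSet_Ioc, Measure.restrict_restrict measurableSet_Ioc,
      Set.inter_eq_self_of_subset_left (Set.Ioc_subset_Ioi_self), setIntegral_const, Real.volume_real_Ioc_of_le hr₀.le,
      sub_zero, smul_eq_mul]
    ring
  have hint : IntegrableOn (fun u => (1 - Real.cos (ω * u)) * bathKinCorr ω₂ lam β γ T N u) (Ioi 0) := by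
    refine Integrable.mono' (hKi.norm.const_mul 2) ?_ ?_
    · exact ((by fun_prop : Continuous fun u => 1 - Real.cos (ω * u)).mul hKc).aestronglyMeasurable
    · filter_upwards with u
      rw [Real.norm_eq_abs, abs_mul, Real.norm_eq_abs]
      have h01 := one_sub_cos_mem_Icc (ω * u)
      rw [abs_of_nonneg h01.1]
      nlinarith [abs_nonneg (bathKinCorr ω₂ lam β γ T N u), h01.2]
  -- pointwise domination on (0,∞): (1 - cos ωu) K(u) ≥ -(L₁ u + L₂ u)
  have hpt : ∀ u ∈ Ioi (0 : ℝ), -(L₁ u + L₂ u) ≤ (1 - Real.cos (ω * u)) * bathKinCorr ω₂ lam β γ T N u := by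
    intro u hu
    have hu0 : (0 : ℝ) < u := hu
    have h01 := one_sub_cos_mem_Icc (ω * u)
    have hL₁0 : 0 ≤ L₁ u := by
      rw [hL₁]; exact mul_nonneg hA (div_nonneg (one_sub_cos_mem_Icc (u * ω)).1 (by positivity))
    have hL₂0 : 0 ≤ L₂ u := by
      rw [hL₂]; exact Set.indicator_nonneg (fun _ _ => by positivity) u
    rcases le_or_gt r₀ u with hru | hur
    · -- u ≥ r₀: kernel floor; u^{-3/2} = 1/(u√u)
      have hk := hK u hru
      have hpow : u ^ (-(3 / 2 : ℝ)) = 1 / (u * Real.sqrt u) := by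
        rw [Real.rpow_neg hu0.le, Real.sqrt_eq_rpow, ← Real.rpow_one_add' hu0.le (by norm_num), one_div]
        norm_num
      rw [hpow] at hk
      have h1 : -(L₁ u) ≤ (1 - Real.cos (ω * u)) * bathKinCorr ω₂ lam β γ T N u := by
        rw [hL₁]
        dsimp only
        rw [mul_comm u ω] 
        have := mul_le_mul_of_nonneg_left hk h01.1
        calc -(A * ((1 - Real.cos (ω * u)) / (u * Real.sqrt u)))
            = (1 - Real.cos (ω * u)) * -(A * (1 / (u * Real.sqrt u))) := by ring
          _ ≤ (1 - Real.cos (ω * u)) * bathKinCorr ω₂ lam β γ T N u := this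
      linarith
    · -- 0 < u < r₀: |K| ≤ 2T² and 1 - cos ωu ≤ (ωu)²/2 ≤ √ω r₀²/2
      have hcos : 1 - Real.cos (ω * u) ≤ (ω * u) ^ 2 / 2 := by
        have := Real.one_sub_sq_div_two_le_cos (x := ω * u); linarith
      have hω2 : ω ^ 2 ≤ Real.sqrt ω := by
        have hωω : ω ^ 2 ≤ ω := by nlinarith
        exact hωω.trans ((Real.le_sqrt' hω0).2 hωω)
      have hL₂u : L₂ u = T ^ 2 * r₀ ^ 2 * Real.sqrt ω := by
        show Set.indicator (Set.Ioc 0 r₀) (fun _ => T ^ 2 * r₀ ^ 2 * Real.sqrt ω) u = _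
        rw [Set.indicator_of_mem (show u ∈ Set.Ioc 0 r₀ from ⟨hu0, hur.le⟩)]
      have hKu := hKb u
      have h2 : -(L₂ u) ≤ (1 - Real.cos (ω * u)) * bathKinCorr ω₂ lam β γ T N u := by
        rw [hL₂u]
        have hlow : -((1 - Real.cos (ω * u)) * (2 * T ^ 2)) ≤ (1 - Real.cos (ω * u)) * bathKinCorr ω₂ lam β γ T N u := by
          have := (abs_le.1 hKu).1
          nlinarith [h01.1]
        refine le_trans ?_ hlow
        rw [neg_le_neg_iff]
        have hu2 : u ^ 2 ≤ r₀ ^ 2 := by gcongr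
        calc (1 - Real.cos (ω * u)) * (2 * T ^ 2) ≤ (ω * u) ^ 2 / 2 * (2 * T ^ 2) := by gcongr
          _ = T ^ 2 * u ^ 2 * ω ^ 2 := by ring
          _ ≤ T ^ 2 * r₀ ^ 2 * Real.sqrt ω := by gcongr
      linarith
  have hnegi : IntegrableOn (fun u => -(L₁ u + L₂ u)) (Ioi 0) := (hL₁i.add hL₂i).neg
  have hmono := setIntegral_mono_on hnegi hint measurableSet_Ioi hpt
  have hsum : ∫ u in Ioi (0 : ℝ), -(L₁ u + L₂ u) = -(A * (Real.sqrt ω * c₂) + T ^ 2 * r₀ ^ 2 * Real.sqrt ω * r₀) := by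
    rw [integral_neg, integral_add hL₁i hL₂i, hL₁v, hL₂v]
  rw [hsum] at hmono
  refine le_trans (le_of_eq ?_) hmono
  ring

end Warburg

/-- ★ **(BKᶠ_{0,3/2}) ⟹ WarburgDipFloor** (node B §8): the kernel floor of NODE 107 is STRONGER than the Warburg dip floor of GEN 92T, which is therefore
the weakest typed sufficient structural piece on the (S)-side (`WarburgDipFloor ⟹ TransientFloor 1`, `transientFloor_one_of_warburgDipFloor`). [this cell] -/
theorem warburgDipFloor_of_bathKernelFloor (hK : BathKernelFloor 0 (3 / 2)) : WarburgDipFloor := by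
  intro ω₂ lam β γ hω hl hβ hγ T hT
  obtain ⟨A, r₀, hr₀, N₀, hA⟩ := hK ω₂ lam β γ hω hl hβ hγ T hT
  set c₂ : ℝ := ∫ v in Ioi (0 : ℝ), (1 - Real.cos v) / (v * Real.sqrt v) with hc₂
  refine ⟨γ / T ^ 2 * (max A 0 * c₂ + T ^ 2 * r₀ ^ 3), max N₀ 1, fun N hN ω hωa => ?_⟩
  have hN₀ : N₀ ≤ N := le_trans (le_max_left _ _) hN
  have hN1 : 0 < N := lt_of_lt_of_le Nat.one_pos (le_trans (le_max_right _ _) hN)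
  have hKf : ∀ u : ℝ, r₀ ≤ u → -(max A 0 * u ^ (-(3 / 2 : ℝ))) ≤ bathKinCorr ω₂ lam β γ T N u := by
    intro u hu
    have h := hA N hN₀ u hu
    simp only [Real.rpow_zero, mul_one] at h
    have hu0 : 0 < u := lt_of_lt_of_le hr₀ hu
    refine le_trans ?_ h
    rw [neg_le_neg_iff]
    exact mul_le_mul_of_nonneg_right (le_max_left _ _) (Real.rpow_nonneg hu0.le _)
  have hγT : 0 < γ / T ^ 2 := by positivity
  -- reduce to ω > 0 by evenness; ω = 0 is trivial
  have key : ∀ ω' : ℝ, 0 < ω' → ω' ≤ 1 →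
      -(γ / T ^ 2 * (max A 0 * c₂ + T ^ 2 * r₀ ^ 3) * Real.sqrt ω') ≤ warburgDip ω₂ lam β γ T N ω' := by
    intro ω' hω'0 hω'1
    have h := integral_one_sub_cos_mul_bathKinCorr_ge hω hl hβ hγ hT hN1 (le_max_right A 0) hr₀ hKf hω'0 hω'1
    unfold warburgDip
    simp only [escapeKernel_eq_bathKinCorr]
    have := mul_le_mul_of_nonneg_left h hγT.le
    refine le_trans (le_of_eq ?_) this
    ring
  rcases lt_trichotomy ω 0 with hneg | hzero | hpos
  · have hω' : 0 < -ω := neg_pos.2 hneg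
    have h := key (-ω) hω' (by rw [abs_of_neg hneg] at hωa; exact hωa)
    have heven : warburgDip ω₂ lam β γ T N (-ω) = warburgDip ω₂ lam β γ T N ω := by
      unfold warburgDip
      congr 1
      refine setIntegral_congr_fun measurableSet_Ioi fun u _ => ?_
      rw [neg_mul, Real.cos_neg]
    rw [abs_of_neg hneg, ← heven]
    exact h
  · subst hzero
    have h0 : warburgDip ω₂ lam β γ T N 0 = 0 := by
      unfold warburgDip; simp
    rw [h0, abs_zero, Real.sqrt_zero, mul_zero, neg_zero]
  · rw [abs_of_pos hpos]
    exact key ω hpos (by rw [abs_of_pos hpos] at hωa; exact hωa)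

/-- (CFᶠ_{0,3/2}) ⟹ WarburgDipFloor. [formal bookkeeping] -/
theorem warburgDipFloor_of_bathCumulantFloor (hC : BathCumulantFloor 0 (3 / 2)) : WarburgDipFloor :=
  warburgDipFloor_of_bathKernelFloor (bathKernelFloor_of_bathCumulantFloor hC)

/-- ★ **The typed (S)-side ladder of one-sided floors, top to bottom** (every arrow proved in the lineage):
`(SQᶠ)∧(VCᶠ) ⟹ (CFᶠ_{0,3/2}) ⟹ (BKᶠ_{0,3/2}) ⟹ WarburgDipFloor ⟹ TransientFloor 1 ⟺ BathTailFloor 1`, and with (S) the blocker. [this cell] -/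
theorem floorLadder :
    (BathStaticCumulantFloor 0 (3 / 2) ∧ BathVarChannelFloor 0 (3 / 2) → BathCumulantFloor 0 (3 / 2)) ∧
    (BathCumulantFloor 0 (3 / 2) → BathKernelFloor 0 (3 / 2)) ∧
    (BathKernelFloor 0 (3 / 2) → WarburgDipFloor) ∧
    (WarburgDipFloor → TransientFloor 1) ∧
    (TransientFloor 1 ↔ BathTailFloor 1) ∧
    (SubdiffusiveBondHeat → BathTailFloor 1 → BoundedResponse) :=
  ⟨fun h => bathCumulantFloor_of_staticCumulantFloor_varChannelFloor h.1 h.2, bathKernelFloor_of_bathCumulantFloor,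
    warburgDipFloor_of_bathKernelFloor, transientFloor_one_of_warburgDipFloor, (bathTailFloor_iff_transientFloor 1).symm,
    fun hS hF => boundedResponse_of_bathHeatPoint_bathTailFloor (bathHeatPoint_one_of_subdiffusiveBondHeat hS) hF⟩


/-- ★ **The channel ladder** (every arrow proved here): `(SQᶠ) ⟹ (CPᶠ)`, `(CPᶠ) ∧ (VCᶠ) ⟹ (BKᶠ_{0,3/2})`, `(SQᶠ) ∧ (VCᶠ) ⟹ (CFᶠ_{0,3/2}) ⟹ (BKᶠ_{0,3/2})`,
and with (S) the blocker. [this cell] -/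
theorem channelLadder :
    (BathStaticCumulantFloor 0 (3 / 2) → BathCommonPastFloor 0 (3 / 2)) ∧
    (BathCommonPastFloor 0 (3 / 2) → BathVarChannelFloor 0 (3 / 2) → BathKernelFloor 0 (3 / 2)) ∧
    (BathStaticCumulantFloor 0 (3 / 2) → BathVarChannelFloor 0 (3 / 2) → BathCumulantFloor 0 (3 / 2)) ∧
    (SubdiffusiveBondHeat → BathCommonPastFloor 0 (3 / 2) → BathVarChannelFloor 0 (3 / 2) → BoundedResponse) :=
  ⟨bathCommonPastFloor_of_staticCumulantFloor, bathKernelFloor_of_commonPastFloor_varChannelFloor,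
    bathCumulantFloor_of_staticCumulantFloor_varChannelFloor, boundedResponse_of_subdiffusiveBondHeat_commonPast_varChannel⟩

end Summit.AtomisticToContinuum.FouriersLaw.Theorems.BoundedResponse.HeatSpreading
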